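import Literature.Probability.LatticeModels.GinibreCharacterExpansion
import Literature.Probability.LatticeModels.VillainKernelPoisson
import Literature.MathematicalPhysics.QuantumLattice.HeatKernelGroupCircleKernelProofs
import Mathlib.MeasureTheory.Integral.DominatedConvergence
import Mathlib.MeasureTheory.Integral.Pi
import HarnessLib

/-!
# Hartman–Watson 1974: the von Mises (Wilson `U(1)` plaquette) weight `e^{β cos θ}` is an exact positive mixture of circle heat kernels (Villain weights)

**Citation header (reproduction of PUBLISHED work).** P. Hartman, G. S. Watson, *"Normal" distribution functions on
spheres and the modified Bessel functions*, Ann. Probab. **2** (1974) 593–607 [HartmanWatson1974]; M. Yor, *Loi de l'indice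
du lacet brownien, et distribution de Hartman–Watson*, Z. Wahrsch. verw. Gebiete **53** (1980) 71–95 [Yor1980]; the
statements used are restated, with the normalisations adopted here, in Y. Hariya, arXiv:1904.00595, p. 3 (1.3)–(1.5)
[Hariya2019] and G. Bernhart, J.-F. Mai (2015) §1–§2, pp. 338–339 [BernhartMai2015] (held; page-read). What is reproduced:
the HARTMAN–WATSON LAW `η_r` is the probability law on `(0, ∞)` with Laplace transform
`∫ e^{-λ²t/2} η_r(dt) = I_λ(r)/I_0(r)` (`λ ≥ 0`; `I_λ` the modified Bessel function; density `Θ(r,t)/I_0(r)` with Yor's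
`Θ(r,t) = (r/√(2π³t)) ∫_0^∞ e^{(π²-y²)/(2t)} e^{-r cosh y} sinh y sin(πy/t) dy`), and Hartman–Watson's reading of it in
directional statistics: the von Mises law `∝ e^{r cos θ} dθ` is the law of a Brownian motion on the circle run for an
independent `η_r`-distributed time ("the most prominent occurrence of the Hartman–Watson distribution",
Bernhart–Mai p. 339). Nothing here is under adjudication.

**Why it is in the tree (lattice gauge theory).** Read with `r = β` and `θ` a plaquette angle, the theorem says that the
WILSON plaquette weight is a positive superposition of circle heat kernels `p_t(e^{iθ}) = ∑_n e^{-n²t/2} cos(nθ)`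
(`circleHeatKernel`), i.e. — by Poisson summation — of VILLAIN weights `v_{1/t}(θ) = ∑_m e^{-(θ+2πm)²/(2t)}`
(`villainKernel`) with a RANDOM inverse coupling `t`:

  `e^{β cos θ} = ∫ p_t(e^{iθ}) η̂_β(dt) = ∫ √(2π/t) v_{1/t}(θ) η̂_β(dt)`,   `η̂_β = I_0(β) η_β`,

equivalently, on the dual (character) side, `I_n(β) = ∫ e^{-n²t/2} η̂_β(dt)` for every `n ∈ ℤ`. Plaquette by plaquette,
the finite-volume Wilson `U(1)` theory at `β` is therefore the ANNEALED Villain theory whose plaquette couplings `1/t_p`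
are i.i.d. `η̂_β`-distributed — an exact bridge between the two standard `U(1)` lattice actions, different from the
analytic interpolation of `n ↦ I_n(β)` used by Fröhlich–Spencer (CMP 81 (1981) App. B) and Cirigliano–Paffuti (CMP 200
(1999)) to transfer Villain-action arguments to the Wilson action.

**What this file PROVES (kernel)**, from the integer-order Laplace transform alone, which is isolated as the hypothesis
structure `IsMixingMeasure β η` (so every theorem is unconditional in the form "for every mixing measure …"):
* `IsMixingMeasure.integral_circleHeatKernel` — THE DICTIONARY `∫ p_t(e^{iθ}) dη(t) = e^{β cos θ}` (Fubini for the
  absolutely summable-integrable double family, `∑_n I_n(β) = e^β`, and the character expansion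
  `e^{β cos θ} = ∑_n I_n(β) cos(nθ)` of `GinibreCharacterExpansion`);
* `circleHeatKernel_exp_eq_villainKernel` — `p_t(e^{iθ}) = √(2π t⁻¹) v_{t⁻¹}(θ)` (the tree's Poisson formula
  `hasSum_villainKernel_cos`), whence `IsMixingMeasure.integral_villainKernel`;
* the lattice (product) forms `IsMixingMeasure.integral_pi_prod_exp` (dual weights `∏_p I_{n_p}(β)`) and
  `IsMixingMeasure.integral_pi_prod_circleHeatKernel` (Boltzmann weights `∏_p e^{β cos θ_p}`).
The EXISTENCE of a mixing measure for every `β > 0` is the cited theorem, recorded as the named fact `HartmanWatsonLaw`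
(not proved here: positivity of Yor's density is the non-elementary point).

**Deliberately not here.** The real-order transform `I_λ`, Yor's density, and the tail
`η_β((t, ∞)) ~ (K_0(β)/I_0(β)) √(2/(πt))` (`t → ∞`; the law has infinite mean — rare plaquettes carry arbitrarily weak
Villain coupling, which is what limits naive "Villain ⇒ Wilson" transfers); measurability/integrability of
`t ↦ p_t(z)` against `η` beyond what the identities need.
-/

noncomputable section

open _root_.MeasureTheory Filter Finset Set
open scoped _root_.Topology
open Literature.Probability.LatticeModels
open Literature.MathematicalPhysics.QuantumLattice
open Literature.MathematicalPhysics.QuantumFieldTheory (villainKernel)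

namespace Literature.Probability.HartmanWatson1974

/-- `η` is a HARTMAN–WATSON MIXING MEASURE at `β`: a finite measure on `ℝ` giving no mass to `(-∞, 0]` whose Gaussian
moments at the integers are the modified Bessel coefficients, `∫ e^{-n²t/2} dη(t) = I_n(β)` for every `n ∈ ℤ`
(`besselI` of `GinibreCharacterExpansion`, defined by its power series). For `β > 0` the measure `I_0(β) · η_β`, `η_β` the
Hartman–Watson law, is such a measure (its Laplace transform is `u ↦ I_{√(2u)}(β)/I_0(β)`).
[cite: HartmanWatson1974, the law η_r with Laplace transform I_λ(r)/I_0(r); restated Hariya2019 p.3 (1.3), BernhartMai2015 p.338] -/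
structure IsMixingMeasure (β : ℝ) (η : Measure ℝ) : Prop where
  /-- `η` is a finite measure. -/
  finite : IsFiniteMeasure η
  /-- `η` is carried by `(0, ∞)`. -/
  null_nonpos : η (Iic 0) = 0
  /-- The integer-order Laplace transform: `∫ e^{-n²t/2} dη = I_n(β)`. -/
  laplace : ∀ n : ℤ, ∫ t, Real.exp (-(n : ℝ) ^ 2 * t / 2) ∂η = besselI n β

/-- **The Hartman–Watson theorem** (NAMED FACT, used as a hypothesis; not proved in the tree): for every `β > 0` there is
a Hartman–Watson mixing measure at `β` — explicitly `η = Θ(β,t) 𝟙_{t>0} dt` with Yor's density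
`Θ(r,t) = (r/√(2π³t)) ∫_0^∞ e^{(π²-y²)/(2t)} e^{-r cosh y} sinh y sin(πy/t) dy ≥ 0`, which satisfies
`∫_0^∞ e^{-λ²t/2} Θ(r,t) dt = I_{|λ|}(r)` for all real `λ`.
[cite: HartmanWatson1974, existence of η_r; density Yor1980, restated Hariya2019 p.3 (1.3)–(1.5)] -/
def HartmanWatsonLaw : Prop :=
  ∀ β : ℝ, 0 < β → ∃ η : Measure ℝ, IsMixingMeasure β η

namespace IsMixingMeasure

variable {β : ℝ} {η : Measure ℝ}

/-- `η`-almost every `t` is positive. [folklore] -/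
theorem ae_pos (h : IsMixingMeasure β η) : ∀ᵐ t ∂η, 0 < t := by
  have hmem : (Iic (0 : ℝ))ᶜ ∈ ae η := compl_mem_ae_iff.mpr h.null_nonpos
  filter_upwards [hmem] with t ht
  simpa using ht

/-- The Gaussian coefficient `t ↦ e^{-n²t/2}` is `η`-integrable (it is bounded by `1` on `(0, ∞)` and `η` is finite).
[folklore] -/
theorem integrable_exp (h : IsMixingMeasure β η) (n : ℤ) :
    Integrable (fun t => Real.exp (-(n : ℝ) ^ 2 * t / 2)) η := by
  haveI := h.finite
  refine (integrable_const (1 : ℝ)).mono' (by fun_prop : Continuous fun t : ℝ =>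
    Real.exp (-(n : ℝ) ^ 2 * t / 2)).aestronglyMeasurable ?_
  filter_upwards [h.ae_pos] with t ht
  rw [Real.norm_eq_abs, abs_of_pos (Real.exp_pos _), Real.exp_le_one_iff]
  have : 0 ≤ (n : ℝ) ^ 2 * t := by positivity
  linarith

/-- The total mass of a mixing measure at `β` is `I_0(β)`. [folklore] -/
theorem measureReal_univ (h : IsMixingMeasure β η) : η.real univ = besselI 0 β := by
  have h0 := h.laplace 0
  simp only [Int.cast_zero, ne_eq, OfNat.ofNat_ne_zero, not_false_eq_true, zero_pow, neg_zero, zero_mul,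
    zero_div, Real.exp_zero, integral_const, smul_eq_mul, mul_one] at h0
  exact h0

/-- **The Hartman–Watson dictionary** (von Mises = Brownian motion on the circle at a Hartman–Watson time; on the
lattice: Wilson weight = mixture of heat-kernel/Villain weights). For a mixing measure `η` at `β` and every angle `θ`,
`∫ p_t(e^{iθ}) dη(t) = e^{β cos θ}`, where `p_t(e^{iθ}) = ∑_{n ∈ ℤ} e^{-n²t/2} cos(nθ)` is `circleHeatKernel`. Proof: the
double family `e^{-n²t/2} cos(nθ)` is absolutely integrable-summable (`∑_n ∫ e^{-n²t/2} dη = ∑_n I_n(β) < ∞`,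
`summable_abs_besselI`), so the integral of the series is the series of the integrals `∑_n I_n(β) cos(nθ)`, which is the
character expansion of `e^{β cos θ}` (`hasSum_besselI_mul_zpow`).
[cite: HartmanWatson1974, von Mises law as Brownian motion on the circle at an independent η_r-time; BernhartMai2015 §2 p.339] -/
theorem integral_circleHeatKernel (h : IsMixingMeasure β η) (θ : ℝ) :
    ∫ t, circleHeatKernel t (Circle.exp θ) ∂η = Real.exp (β * Real.cos θ) := by
  set F : ℤ → ℝ → ℝ := fun n t =>
    Real.exp (-(n : ℝ) ^ 2 * t / 2) * (((Circle.exp θ ^ n : Circle) : ℂ)).re with hF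
  have hint : ∀ n, Integrable (F n) η := fun n => (h.integrable_exp n).mul_const _
  have hre : ∀ n : ℤ, |(((Circle.exp θ ^ n : Circle) : ℂ)).re| ≤ 1 := fun n =>
    (Complex.abs_re_le_norm _).trans (Circle.norm_coe _).le
  have hnorm : ∀ n, ∫ t, ‖F n t‖ ∂η ≤ |besselI n β| := fun n => by
    refine le_trans ?_ ((h.laplace n).le.trans (le_abs_self _))
    refine integral_mono (hint n).norm (h.integrable_exp n) fun t => ?_
    simp only [hF, norm_mul, Real.norm_eq_abs, abs_of_pos (Real.exp_pos _)]
    exact mul_le_of_le_one_right (Real.exp_pos _).le (hre n)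
  have hsum : Summable fun n => ∫ t, ‖F n t‖ ∂η :=
    (summable_abs_besselI β).of_nonneg_of_le (fun n => integral_nonneg fun t => norm_nonneg _) hnorm
  have hterm : ∀ n, ∫ t, F n t ∂η = besselI n β * Real.cos (n * θ) := fun n => by
    simp only [hF]
    rw [integral_mul_const, h.laplace n, re_coe_circleExp_zpow]
  change ∫ t, ∑' n, F n t ∂η = _
  rw [← integral_tsum_of_summable_integral_norm hint hsum]
  simp_rw [hterm]
  have hs := Complex.hasSum_re (hasSum_besselI_mul_zpow β (Circle.exp θ))
  have hs' : HasSum (fun m : ℤ => besselI m β * Real.cos (m * θ)) (Real.exp (β * Real.cos θ)) := by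
    have hval : ((Real.exp (β * (Circle.exp θ : ℂ).re) : ℝ) : ℂ).re = Real.exp (β * Real.cos θ) := by
      rw [Complex.ofReal_re, Circle.coe_exp, Complex.exp_ofReal_mul_I_re]
    rw [← hval]
    refine hs.congr_fun fun m => ?_
    rw [Complex.re_ofReal_mul, ← Circle.coe_zpow, re_coe_circleExp_zpow]
  exact hs'.tsum_eq

end IsMixingMeasure

/-- The circle heat kernel at time `t > 0` is the Villain weight of inverse coupling `t⁻¹` up to the factor `√(2π t⁻¹)`:
`p_t(e^{iθ}) = √(2π/t) ∑_m e^{-(θ + 2πm)²/(2t)} = √(2π t⁻¹) · v_{t⁻¹}(θ)` (Poisson summation; the tree's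
`hasSum_villainKernel_cos`). [folklore] -/
theorem circleHeatKernel_exp_eq_villainKernel {t : ℝ} (ht : 0 < t) (θ : ℝ) :
    circleHeatKernel t (Circle.exp θ) = Real.sqrt (2 * Real.pi * t⁻¹) * villainKernel t⁻¹ θ := by
  have hsq : Real.sqrt (2 * Real.pi * t⁻¹) ≠ 0 := (Real.sqrt_pos.2 (by positivity)).ne'
  have hv := (hasSum_villainKernel_cos (inv_pos.mpr ht) θ).mul_left (Real.sqrt (2 * Real.pi * t⁻¹))
  have hv' : HasSum (fun n : ℤ => Real.exp (-(n : ℝ) ^ 2 * t / 2) * (((Circle.exp θ ^ n : Circle) : ℂ)).re)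
      (Real.sqrt (2 * Real.pi * t⁻¹) * villainKernel t⁻¹ θ) := by
    refine hv.congr_fun fun n => ?_
    have h1 : -(n : ℝ) ^ 2 / (2 * t⁻¹) = -(n : ℝ) ^ 2 * t / 2 := by
      rw [div_eq_mul_inv, mul_inv, inv_inv]; ring
    rw [re_coe_circleExp_zpow, h1, mul_comm θ, ← mul_assoc, mul_div_assoc', mul_div_cancel_left₀ _ hsq]
  exact hv'.tsum_eq

namespace IsMixingMeasure

variable {β : ℝ} {η : Measure ℝ}

/-- **The dictionary in Villain form**: `∫ √(2π t⁻¹) v_{t⁻¹}(θ) dη(t) = e^{β cos θ}` — the Wilson plaquette weight is a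
positive superposition of Villain weights `v_{β'}` with random coupling `β' = 1/t`, `t ∼ η`.
[cite: HartmanWatson1974, von Mises law as stopped Brownian motion (Villain = wrapped normal form); BernhartMai2015 §2 p.339] -/
theorem integral_villainKernel (h : IsMixingMeasure β η) (θ : ℝ) :
    ∫ t, Real.sqrt (2 * Real.pi * t⁻¹) * villainKernel t⁻¹ θ ∂η = Real.exp (β * Real.cos θ) := by
  rw [← h.integral_circleHeatKernel θ]
  refine integral_congr_ae ?_
  filter_upwards [h.ae_pos] with t ht
  exact (circleHeatKernel_exp_eq_villainKernel ht θ).symm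

/-- **Annealed form of the dual (integer-current) weights.** For finitely many plaquettes `p` carrying integer currents
`n_p`, the Wilson dual weight `∏_p I_{n_p}(β)` (the plaquette weight of the `ℤ`-valued dual model) is the
`η^{⊗P}`-average of the Villain dual weights `∏_p e^{-n_p² t_p/2}` with independent `t_p ∼ η`. [folklore] -/
theorem integral_pi_prod_exp (h : IsMixingMeasure β η) {ι : Type*} [Fintype ι] (n : ι → ℤ) :
    ∫ t, ∏ p, Real.exp (-(n p : ℝ) ^ 2 * t p / 2) ∂(Measure.pi fun _ : ι => η) = ∏ p, besselI (n p) β := by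
  haveI := h.finite
  rw [integral_fintype_prod_eq_prod (fun p (s : ℝ) => Real.exp (-(n p : ℝ) ^ 2 * s / 2))]
  exact Finset.prod_congr rfl fun p _ => h.laplace (n p)

/-- **Annealed form of the Wilson Boltzmann weight (lattice form of the dictionary).** For finitely many plaquette angles
`θ_p`, `∫ ∏_p p_{t_p}(e^{iθ_p}) dη^{⊗P}(t) = ∏_p e^{β cos θ_p}`: the finite-volume Wilson weight at `β` is the average,
over independent `t_p ∼ η`, of the heat-kernel (Villain) weights with plaquette-dependent couplings `1/t_p`. [folklore] -/
theorem integral_pi_prod_circleHeatKernel (h : IsMixingMeasure β η) {ι : Type*} [Fintype ι] (θ : ι → ℝ) :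
    ∫ t, ∏ p, circleHeatKernel (t p) (Circle.exp (θ p)) ∂(Measure.pi fun _ : ι => η) =
      ∏ p, Real.exp (β * Real.cos (θ p)) := by
  haveI := h.finite
  rw [integral_fintype_prod_eq_prod (fun p (s : ℝ) => circleHeatKernel s (Circle.exp (θ p)))]
  exact Finset.prod_congr rfl fun p _ => h.integral_circleHeatKernel (θ p)

end IsMixingMeasure

end Literature.Probability.HartmanWatson1974
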